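import Summits.QuantumFields.BalabanUV.T4Continuum.Support.RegionGaugeCheckerboardPaths
import Summits.QuantumFields.BalabanUV.T4Continuum.Support.RegionStarLineGaugeBound
import Mathlib.Analysis.PSeries

/-!
# `BalabanUV.T4Continuum.Support.RegionGaugeCheckerboardNoGo` — NE2 (node U1a) formalisation swarm, sub-row `T4-U1a.S-NE2-D1-DIRICHLET°`
# (vector layer, W1), FINDING F-ne2leaf09g9-1 as a KERNEL THEOREM: **THE DISPLAYED W1 BINDER WITH ONE LEVEL-UNIFORM CONSTANT IS UNSATISFIABLE
# ON THE COMPLEMENT OF A DIAGONAL PAIR OF BLOCKS** — every slice constant `c` of the [B9]-faithful `U = 1` region vector operator `Δ_a(Ω₀)` on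
# `Ω₀ = T ∖ (w ∪ w′)`, `w′ = w + e + e_ν`, obeys `c·H_n ≤ 6d·a` (`H_n` the harmonic number), so `c_k ≲ a/(k·log L)` along the tower
# (unit b2b-balaban-t4-ne2-formalise-leaf-09, gen 9, v1)

HONEST FRAMING (T4-DAG p. 1).  [folklore] `U = 1`, model level, ONE region family (needs `e ≠ ν`, `2 ≤ M e`, `2 ≤ M ν`), one averaging scale,
finite torus, star bonds — a LOCATED NO-GO for ONE displayed binder (leaf-07-g5's `SliceCoercive … c` with `c` independent of the level, as it
enters `hS : ∀ k, SliceCoercive …_k c` of the star-bond tower ENDs) on ONE family of block unions: the lattice shadow of the NON-LIPSCHITZ contact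
point of the electric boundary-value problem (two exterior cubes touching along a codimension-2 face).  It does NOT concern boxes (owner O14-a),
`e`-thin sets (`RegionStarLineGaugeEnd`), `S = ⊤`, or regions whose exterior blocks never touch along codimension-2 faces; it says nothing about
[B9]'s regions (which carry (3.16)'s collars); nothing printed is a hypothesis or is objected to; NE2 (U1a) NOT proved; spine PROVED 0/9 unchanged;
NOT [B9] (3.23)–(3.27) as printed; NOT infinite volume, NOT the mass gap, NOT Clay.  HONEST DEPENDENCY (verbatim): «continuum YM on T⁴ ⇐
BetaPertH ∧ nine spine estimates (0/9 proved); BetaPertH ⇐ (D1) ∧ (D4) ∧ CAP+tail; G-an2-4 gates asym, D1 and NE2/3/4.»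

WHAT THIS FILE PROVES (0 sorry), on top of `RegionGaugeCheckerboardField` (test field `A = ∂1_{w′}`: `curlR A = 0`, `n^d·nsq (avgR A) ≤ 2d·n^d`)
and `RegionGaugeCheckerboardPaths` (every shell path carries residual energy `≥ n²/(3(r+1))` for EVERY Dirichlet gauge):
 * §1 digit-sum bookkeeping: `harm n = Σ_{t<n} 1/(t+1)`, `sum_digit_fn` (`n·Σ_j f(j_e) = n^d·Σ_t f t`), the range ↔ digit conversions
   `sum_range_eq_sum_fin` ∕ `sum_range_shift_eq_sum_fin`, `harm_unbounded` (Mathlib's divergence of the harmonic series).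
 * §2 THE CAPACITY LOWER BOUND **`nsq_sub_gradR_testField_ge`**: `n^d·H_n/3 ≤ nsq (testField − gradR μ)` for EVERY Dirichlet `μ` — the shell
   paths are bond-disjoint (three explicit injections of the path bonds into the bonds of the blocks `w` and `w + e`), so their energies add up
   inside `nsq`.
 * §3 THE NO-GO **`sliceCoercive_checker_le`**: `SliceCoercive (curlR n M S✗) (gradR n M S✗) (GOm n M a′ S✗) (QOm n M S✗) (avgR n M S✗) (a·n^d) c
   → 0 ≤ c → 0 < a′ → c·H_n ≤ 6·d·a` (gen 8/9's chain `SliceCoercive ⟹ OrthSliceCoercive ⟹ orbit inequality` applied to the test field), and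
   **`not_sliceCoercive_uniform_checker`**: for every `c > 0` some level `n` violates `SliceCoercive … c` (the harmonic series diverges) — NO
   level-uniform slice constant exists on this region.

ABSOLUTE RULE (cell, verbatim): «No internally-minted statement may enter as a cited fact. Every hypothesis is either kernel-proved in
this package or a verbatim quotation of a PUBLISHED theorem with page reference. The manuscript(s) under audit are NOT citable for
their own disputed steps — they are the thing under adjudication; programme-internal (2001/route/tribunal) claims are never citable.»
[folklore] throughout; one real function `harm`; no `def … : Prop`.  NOT CLAIMED: anything about other regions; NE2; NE3; «not in print; our no-go».
-/

noncomputable section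

open scoped BigOperators ComplexConjugate Matrix
open Finset

namespace Summit.QuantumFields.BalabanUV.T4Continuum.RegionGaugeCheckerboardNoGo

open Literature.MathematicalPhysics.QuantumFieldTheory.Balaban1983to89.B5Prop11Plancherel (Tor fine unitVec)
open Literature.MathematicalPhysics.QuantumFieldTheory.Balaban1983to89.B5Prop11Lower (nsq nsq_nonneg)
open Literature.MathematicalPhysics.QuantumFieldTheory.Balaban1983to89.B5Block118 (bpt tstep tstep_zero tstep_succ)
open Literature.MathematicalPhysics.QuantumFieldTheory.Balaban1983to89.B5Blocks16 (blockOf blockOf_bpt)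
open Summit.QuantumFields.BalabanUV.T4Continuum
open Summit.QuantumFields.BalabanUV.T4Continuum.SubtypeCompression (ext nsq_ext)
open Summit.QuantumFields.BalabanUV.T4Continuum.RegionScalarCompression (QOm GOm)
open Summit.QuantumFields.BalabanUV.T4Continuum.RegionGaugeFixedVector (starReg curlR gradR avgR)
open Summit.QuantumFields.BalabanUV.T4Continuum.RegionGaugeSlice (SliceCoercive)
open Summit.QuantumFields.BalabanUV.T4Continuum.RegionGaugeSliceOrthRegion (orthSlice_region_of_sliceCoercive)
open Summit.QuantumFields.BalabanUV.T4Continuum.RegionGaugeOrbit (gaugePoincare_of_orthSlice)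
open Summit.QuantumFields.BalabanUV.T4Continuum.RegionStarLineGauge (tstep_add lastD)
open Summit.QuantumFields.BalabanUV.T4Continuum.RegionStarLineGaugeBound (sum_update_const sum_layer_le)
open Summit.QuantumFields.BalabanUV.T4Continuum.RegionGaugeCheckerboardField
open Summit.QuantumFields.BalabanUV.T4Continuum.RegionGaugeCheckerboardPaths
open Summit.QuantumFields.BalabanUV.Beta.GAN24.DirichletBoxTrace (blockReg sum_eq_sum_bpt sum_update_layers' bpt_update_add_tstep)

variable {d : ℕ} (n : ℕ) [NeZero n] (M : Fin d → ℕ) [hM : ∀ μ, NeZero (M μ)] {w : Tor M} {e ν : Fin d}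

/-! ## §1 Digit-sum bookkeeping -/

/-- the HARMONIC NUMBER `H_n = Σ_{t<n} 1/(t+1)`. [folklore] -/
def harm (n : ℕ) : ℝ := ∑ t ∈ range n, 1 / ((t : ℝ) + 1)

omit hM in
/-- summing a function of ONE digit over the digit cube: `n·Σ_j f(j_e) = n^d·Σ_t f t`. [folklore] -/
theorem sum_digit_fn (e : Fin d) (f : Fin n → ℝ) : (n : ℝ) * ∑ j : Fin d → Fin n, f (j e) = (n : ℝ) ^ d * ∑ t : Fin n, f t := by
  -- fibre over the `e`-digit: every fibre has the same size `N`, and `n·N = n^d`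
  set N : ℝ := ((univ.filter (fun j : Fin d → Fin n => (j e : ℕ) = 0)).card : ℝ) with hN
  have h1 : ∑ j : Fin d → Fin n, f (j e) = N * ∑ t : Fin n, f t := by
    rw [sum_update_layers' n e (fun j => f (j e)), mul_sum]
    refine sum_congr rfl fun t _ => ?_
    simp only [Function.update_self, sum_const, nsmul_eq_mul, hN]
  have h2 : ((n : ℝ)) ^ d = n * N := by
    have h := sum_update_layers' n e (fun _ : Fin d → Fin n => (1 : ℝ))
    simp only [sum_const, card_univ, Fintype.card_fun, Fintype.card_fin, nsmul_eq_mul, mul_one] at h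
    rw [hN]; exact_mod_cast h
  rw [h1, h2]; ring

omit [NeZero n] in
/-- a `range` sum below `r ≤ n` as a digit sum with an indicator. [folklore] -/
theorem sum_range_eq_sum_fin {r : ℕ} (hr : r ≤ n) (g : ℕ → ℝ) :
    ∑ i ∈ range r, g i = ∑ i : Fin n, (if (i : ℕ) < r then g i else 0) := by
  rw [Fin.sum_univ_eq_sum_range (fun i => if i < r then g i else 0) n]
  obtain ⟨k, rfl⟩ : ∃ k, n = r + k := ⟨n - r, by omega⟩
  rw [sum_range_add]
  have h1 : ∑ x ∈ range r, (if x < r then g x else 0) = ∑ i ∈ range r, g i := sum_congr rfl fun x hx => if_pos (mem_range.mp hx)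
  have h2 : ∑ x ∈ range k, (if r + x < r then g (r + x) else 0) = 0 := sum_eq_zero fun x _ => if_neg (by omega)
  rw [h1, h2, add_zero]

omit [NeZero n] in
/-- a shifted `range` sum `Σ_{m<r+1} g(h+m)` with `h + r + 1 = n` as a digit sum with the indicator `h ≤ l`. [folklore] -/
theorem sum_range_shift_eq_sum_fin {h r : ℕ} (hn : h + (r + 1) = n) (g : ℕ → ℝ) :
    ∑ m ∈ range (r + 1), g (h + m) = ∑ l : Fin n, (if h ≤ (l : ℕ) then g l else 0) := by
  have h1 : ∑ x ∈ range h, (if h ≤ x then g x else 0) = 0 := sum_eq_zero fun x hx => if_neg (by have := mem_range.mp hx; omega)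
  have h2 : ∑ x ∈ range (r + 1), (if h ≤ h + x then g (h + x) else 0) = ∑ m ∈ range (r + 1), g (h + m) :=
    sum_congr rfl fun x _ => if_pos (Nat.le_add_right h x)
  rw [Fin.sum_univ_eq_sum_range (fun l => if h ≤ l then g l else 0) n]
  conv_rhs => rw [← hn, sum_range_add]
  rw [h1, h2, zero_add]

omit [NeZero n] in
/-- a digit with value `0` is the digit `0`. [folklore] -/
theorem fin_eq_zero_of_val [NeZero n] {i : Fin n} (h : (i : ℕ) = 0) : i = 0 := Fin.ext (by rw [h, Fin.val_zero])

/-! ## §2 The capacity lower bound: the shell paths are bond-disjoint -/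

variable (μ : {x // blockReg n M (checker M w e ν) x} → ℂ)

omit hM in
/-- the path sites in the chart: `start j = n·w + K_E(j)`, `K_E(j) = j₀[e ↦ n−1][ν ↦ n−1−r]`. [folklore] -/
theorem start_eq (hne : e ≠ ν) (j : Fin d → Fin n) :
    start n M w e ν j = bpt n M w (Function.update (Function.update (jz n ν j) e (lastD n)) ν (height n e j)) := by
  unfold start
  exact bpt_add_tstep_nu n w (by rw [Function.update_of_ne (Ne.symm hne)]; exact jz_nu n j) _

omit hM in
/-- `base j + i·e = n·(w+e) + j₀[e ↦ i][ν ↦ n−1−r]` for `i < n`. [folklore] -/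
theorem base_add_eq (hne : e ≠ ν) (j : Fin d → Fin n) (i : Fin n) :
    base n M w e ν j + tstep (fine n M) e i = bpt n M (vb M w e) (Function.update (Function.update (jz n ν j) e i) ν (height n e j)) := by
  unfold base
  rw [add_right_comm, bpt_update_add_tstep n M _ _ e i]
  exact bpt_add_tstep_nu n _ (by rw [Function.update_of_ne (Ne.symm hne)]; exact jz_nu n j) _

omit hM in
/-- `corner j + m·e_ν = n·(w+e) + j₀[ν ↦ l]` with `l = n−1−r+m < n`. [folklore] -/
theorem corner_add_eq (j : Fin d → Fin n) (l : Fin n) {m : ℕ} (hl : (height n e j : ℕ) + m = l) :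
    corner n M w e ν j + tstep (fine n M) ν m = bpt n M (vb M w e) (Function.update (jz n ν j) ν l) := by
  unfold corner
  rw [add_assoc, ← tstep_add, hl]
  exact bpt_add_tstep_nu n _ (jz_nu n j) l

omit hM in
/-- recovering `j` with `j_ν = 0` from `j₀` and the `e`-digit: if `j_ν = j′_ν = 0`, `j_e = j′_e` and `j₀, j′₀` agree off `{e, ν}`, then `j = j′`.
[folklore] -/
theorem eq_of_digits {j j' : Fin d → Fin n} (hj : j ν = 0) (hj' : j' ν = 0) (he : j e = j' e)
    (hrest : ∀ k, k ≠ e → k ≠ ν → jz n ν j k = jz n ν j' k) : j = j' := by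
  funext k
  by_cases hke : k = e
  · subst hke; exact he
  by_cases hkν : k = ν
  · subst hkν; rw [hj, hj']
  have := hrest k hke hkν
  simpa [jz, Function.update_of_ne hkν] using this

omit [NeZero n] hM in
/-- the height determines the shell: `n − 1 − r = n − 1 − r′ ⟹ r = r′` for `r, r′ < n`. [folklore] -/
theorem shell_eq_of_height_eq {j j' : Fin d → Fin n} (h : height n e j = height n e j') : j e = j' e := by
  have h1 := congrArg Fin.val h
  simp only [height] at h1
  have := shell_lt n e j; have := shell_lt n e j'
  unfold shell at *
  exact Fin.ext (by omega)

/-- **(E) THE ENTRY BONDS ARE DISTINCT**: `Σ_{j : j_ν = 0} ‖G(start j, e)‖² ≤ Σ_J ‖G(n·w + J, e)‖²`. [folklore] -/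
theorem sum_entry_le (hne : e ≠ ν) :
    ∑ j ∈ univ.filter (fun j : Fin d → Fin n => (j ν : ℕ) = 0), ‖G n μ (start n M w e ν j, e)‖ ^ 2
      ≤ ∑ J : Fin d → Fin n, ‖G n μ (bpt n M w J, e)‖ ^ 2 := by
  set F := univ.filter (fun j : Fin d → Fin n => (j ν : ℕ) = 0) with hF
  set ψ : (Fin d → Fin n) → (Fin d → Fin n) := fun j => Function.update (Function.update (jz n ν j) e (lastD n)) ν (height n e j) with hψ
  have hinj : Set.InjOn ψ F := by
    intro j hj j' hj' h
    have hjν : j ν = 0 := fin_eq_zero_of_val n (by simpa [hF] using hj)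
    have hj'ν : j' ν = 0 := fin_eq_zero_of_val n (by simpa [hF] using hj')
    have hh : height n e j = height n e j' := by
      have := congrFun h ν; simpa [hψ] using this
    refine eq_of_digits n hjν hj'ν (shell_eq_of_height_eq n hh) fun k hke hkν => ?_
    have := congrFun h k
    simpa [hψ, Function.update_of_ne hkν, Function.update_of_ne hke] using this
  calc ∑ j ∈ F, ‖G n μ (start n M w e ν j, e)‖ ^ 2 = ∑ j ∈ F, ‖G n μ (bpt n M w (ψ j), e)‖ ^ 2 :=
        sum_congr rfl fun j _ => by rw [start_eq n M hne j]
    _ = ∑ J ∈ F.image ψ, ‖G n μ (bpt n M w J, e)‖ ^ 2 := (sum_image (f := fun J => ‖G n μ (bpt n M w J, e)‖ ^ 2) hinj).symm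
    _ ≤ ∑ J : Fin d → Fin n, ‖G n μ (bpt n M w J, e)‖ ^ 2 :=
        sum_le_sum_of_subset_of_nonneg (subset_univ _) fun _ _ _ => by positivity

/-- **(H) THE HORIZONTAL BONDS ARE DISTINCT**: `Σ_{j : j_ν = 0} Σ_{i<r} ‖G(base j + i·e, e)‖² ≤ Σ_J ‖G(n·(w+e) + J, e)‖²`. [folklore] -/
theorem sum_horizontal_le (hne : e ≠ ν) :
    ∑ j ∈ univ.filter (fun j : Fin d → Fin n => (j ν : ℕ) = 0), ∑ i ∈ range (shell n e j), ‖G n μ (base n M w e ν j + tstep (fine n M) e i, e)‖ ^ 2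
      ≤ ∑ J : Fin d → Fin n, ‖G n μ (bpt n M (vb M w e) J, e)‖ ^ 2 := by
  set F := univ.filter (fun j : Fin d → Fin n => (j ν : ℕ) = 0) with hF
  -- pairs `(j, i)` with `i < r`
  set P := (F ×ˢ (univ : Finset (Fin n))).filter (fun p : (Fin d → Fin n) × Fin n => (p.2 : ℕ) < shell n e p.1) with hP
  set ψ : (Fin d → Fin n) × Fin n → (Fin d → Fin n) :=
    fun p => Function.update (Function.update (jz n ν p.1) e p.2) ν (height n e p.1) with hψ
  have hinj : Set.InjOn ψ P := by
    rintro ⟨j, i⟩ hp ⟨j', i'⟩ hp' h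
    simp only [hP, hF, coe_filter, mem_filter, mem_product, mem_univ, and_true, true_and, Set.mem_setOf_eq] at hp hp'
    have hjν : j ν = 0 := fin_eq_zero_of_val n hp.1
    have hj'ν : j' ν = 0 := fin_eq_zero_of_val n hp'.1
    have hh : height n e j = height n e j' := by have := congrFun h ν; simpa [hψ] using this
    have hi : i = i' := by have := congrFun h e; simpa [hψ, Function.update_of_ne hne, Function.update_self] using this
    have hj : j = j' := eq_of_digits n hjν hj'ν (shell_eq_of_height_eq n hh) fun k hke hkν => by
      have := congrFun h k; simpa [hψ, Function.update_of_ne hkν, Function.update_of_ne hke] using this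
    rw [hj, hi]
  have hrew : ∀ j ∈ F, ∑ i ∈ range (shell n e j), ‖G n μ (base n M w e ν j + tstep (fine n M) e i, e)‖ ^ 2
      = ∑ i : Fin n, (if (i : ℕ) < shell n e j then ‖G n μ (bpt n M (vb M w e) (ψ (j, i)), e)‖ ^ 2 else 0) := by
    intro j _
    rw [sum_range_eq_sum_fin n (shell_lt n e j).le]
    refine sum_congr rfl fun i _ => ?_
    split_ifs
    · rw [base_add_eq n M hne j i]
    · rfl
  rw [sum_congr rfl hrew]
  have hpair : ∑ p ∈ P, ‖G n μ (bpt n M (vb M w e) (ψ p), e)‖ ^ 2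
      = ∑ j ∈ F, ∑ i : Fin n, (if (i : ℕ) < shell n e j then ‖G n μ (bpt n M (vb M w e) (ψ (j, i)), e)‖ ^ 2 else 0) := by
    rw [hP, sum_filter, sum_product]
  rw [← hpair, ← sum_image (f := fun J => ‖G n μ (bpt n M (vb M w e) J, e)‖ ^ 2) hinj]
  exact sum_le_sum_of_subset_of_nonneg (subset_univ _) fun _ _ _ => by positivity

/-- **(V) THE VERTICAL BONDS ARE DISTINCT**: `Σ_{j : j_ν = 0} Σ_{m ≤ r} ‖G(corner j + m·e_ν, ν)‖² ≤ Σ_J ‖G(n·(w+e) + J, ν)‖²`. [folklore] -/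
theorem sum_vertical_le :
    ∑ j ∈ univ.filter (fun j : Fin d → Fin n => (j ν : ℕ) = 0), ∑ m ∈ range (shell n e j + 1), ‖G n μ (corner n M w e ν j + tstep (fine n M) ν m, ν)‖ ^ 2
      ≤ ∑ J : Fin d → Fin n, ‖G n μ (bpt n M (vb M w e) J, ν)‖ ^ 2 := by
  set F := univ.filter (fun j : Fin d → Fin n => (j ν : ℕ) = 0) with hF
  set P := (F ×ˢ (univ : Finset (Fin n))).filter (fun p : (Fin d → Fin n) × Fin n => (height n e p.1 : ℕ) ≤ (p.2 : ℕ)) with hP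
  set ψ : (Fin d → Fin n) × Fin n → (Fin d → Fin n) := fun p => Function.update (jz n ν p.1) ν p.2 with hψ
  have hinj : Set.InjOn ψ P := by
    rintro ⟨j, l⟩ hp ⟨j', l'⟩ hp' h
    simp only [hP, hF, coe_filter, mem_filter, mem_product, mem_univ, and_true, true_and, Set.mem_setOf_eq] at hp hp'
    have hjν : j ν = 0 := fin_eq_zero_of_val n hp.1
    have hj'ν : j' ν = 0 := fin_eq_zero_of_val n hp'.1
    have hl : l = l' := by have := congrFun h ν; simpa [hψ] using this
    have hj : j = j' := by
      funext k
      by_cases hkν : k = ν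
      · subst hkν; rw [hjν, hj'ν]
      · have := congrFun h k; simpa [hψ, jz, Function.update_of_ne hkν] using this
    rw [hj, hl]
  have hrew : ∀ j ∈ F, ∑ m ∈ range (shell n e j + 1), ‖G n μ (corner n M w e ν j + tstep (fine n M) ν m, ν)‖ ^ 2
      = ∑ l : Fin n, (if (height n e j : ℕ) ≤ (l : ℕ) then ‖G n μ (bpt n M (vb M w e) (ψ (j, l)), ν)‖ ^ 2 else 0) := by
    intro j _
    have hr := shell_lt n e j
    have hhn : (height n e j : ℕ) + (shell n e j + 1) = n := by simp [height]; omega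
    have key := sum_range_shift_eq_sum_fin n hhn (fun l => ‖G n μ (corner n M w e ν j + tstep (fine n M) ν (l - (height n e j : ℕ)), ν)‖ ^ 2)
    simp only [Nat.add_sub_cancel_left] at key
    rw [key]
    refine sum_congr rfl fun l _ => ?_
    split_ifs with hle
    · rw [corner_add_eq n M j l (Nat.add_sub_cancel' hle)]
    · rfl
  rw [sum_congr rfl hrew]
  have hpair : ∑ p ∈ P, ‖G n μ (bpt n M (vb M w e) (ψ p), ν)‖ ^ 2
      = ∑ j ∈ F, ∑ l : Fin n, (if (height n e j : ℕ) ≤ (l : ℕ) then ‖G n μ (bpt n M (vb M w e) (ψ (j, l)), ν)‖ ^ 2 else 0) := by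
    rw [hP, sum_filter, sum_product]
  rw [← hpair, ← sum_image (f := fun J => ‖G n μ (bpt n M (vb M w e) J, ν)‖ ^ 2) hinj]
  exact sum_le_sum_of_subset_of_nonneg (subset_univ _) fun _ _ _ => by positivity

/-- the three block-direction families sit inside `nsq (G μ)` (`w ≠ w + e`, `e ≠ ν`). [folklore] -/
theorem three_families_le (hMe : 2 ≤ M e) (hne : e ≠ ν) :
    ∑ J : Fin d → Fin n, ‖G n μ (bpt n M w J, e)‖ ^ 2 + ∑ J : Fin d → Fin n, ‖G n μ (bpt n M (vb M w e) J, e)‖ ^ 2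
        + ∑ J : Fin d → Fin n, ‖G n μ (bpt n M (vb M w e) J, ν)‖ ^ 2 ≤ nsq (G n μ) := by
  have hwv : w ≠ vb M w e := by
    intro h; have h1 := congrFun h e
    simp only [vb, Pi.add_apply, unitVec, Pi.single_eq_same] at h1
    exact one_ne_zero_of_two_le hMe ((add_eq_left).mp h1.symm)
  set T : Tor M → ℝ := fun y => ∑ J : Fin d → Fin n, ∑ μ' : Fin d, ‖G n μ (bpt n M y J, μ')‖ ^ 2 with hT
  have hnsq : nsq (G n μ) = ∑ y : Tor M, T y := by
    unfold nsq
    rw [Fintype.sum_prod_type, sum_eq_sum_bpt n M]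
  have hT0 : ∀ y, 0 ≤ T y := fun y => sum_nonneg fun _ _ => sum_nonneg fun _ _ => by positivity
  -- `T w + T (w+e) ≤ Σ_y T y`
  have h2 : T w + T (vb M w e) ≤ ∑ y : Tor M, T y := by
    rw [← sum_pair hwv]
    exact sum_le_sum_of_subset_of_nonneg (subset_univ _) fun y _ _ => hT0 y
  -- inside the blocks: single directions
  have hw : ∑ J : Fin d → Fin n, ‖G n μ (bpt n M w J, e)‖ ^ 2 ≤ T w :=
    sum_le_sum fun J _ => single_le_sum (f := fun μ' => ‖G n μ (bpt n M w J, μ')‖ ^ 2) (fun _ _ => by positivity) (mem_univ e)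
  have hv : ∑ J : Fin d → Fin n, ‖G n μ (bpt n M (vb M w e) J, e)‖ ^ 2 + ∑ J : Fin d → Fin n, ‖G n μ (bpt n M (vb M w e) J, ν)‖ ^ 2
      ≤ T (vb M w e) := by
    rw [← sum_add_distrib]
    refine sum_le_sum fun J _ => ?_
    rw [← sum_pair (f := fun μ' => ‖G n μ (bpt n M (vb M w e) J, μ')‖ ^ 2) hne]
    exact sum_le_sum_of_subset_of_nonneg (subset_univ _) fun _ _ _ => by positivity
  rw [hnsq]; linarith

/-- **THE CAPACITY LOWER BOUND**: for EVERY Dirichlet gauge `μ`, `n^d·H_n/3 ≤ nsq (testField − ∂_Ω μ)` — the residual energy of the test field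
cannot be gauged below the lattice capacity of the diagonal contact (`e ≠ ν`, `2 ≤ M e`, `2 ≤ M ν`). [folklore] -/
theorem nsq_sub_gradR_testField_ge (hMe : 2 ≤ M e) (hMν : 2 ≤ M ν) (hne : e ≠ ν) :
    (n : ℝ) ^ d * harm n / 3 ≤ nsq (testField n M w e ν - gradR n M (checker M w e ν) *ᵥ μ) := by
  have hn0 : (0 : ℝ) < n := by exact_mod_cast Nat.pos_of_ne_zero (NeZero.ne n)
  set F := univ.filter (fun j : Fin d → Fin n => (j ν : ℕ) = 0) with hF
  -- (1) per path, summed over the distinct paths `j ∈ F`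
  have hpaths : ∑ j ∈ F, (n : ℝ) ^ 2 / (3 * ((shell n e j : ℝ) + 1)) ≤ ∑ j ∈ F, pathEnergy n μ j := by
    refine sum_le_sum fun j _ => ?_
    have h3 : (0 : ℝ) < 3 * ((shell n e j : ℝ) + 1) := by have h0 : (0 : ℝ) ≤ (shell n e j : ℝ) := Nat.cast_nonneg _; linarith
    rw [div_le_iff₀ h3]
    have := pathEnergy_ge n hMe hMν hne μ j
    linarith
  -- (2) the paths are bond-disjoint: their energies sit inside `nsq`
  have hdisj : ∑ j ∈ F, pathEnergy n μ j ≤ nsq (G n μ) := by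
    have e1 := sum_entry_le n M μ hne
    have e2 := sum_horizontal_le n M μ hne
    have e3 := sum_vertical_le n M (e := e) μ
    have e4 := three_families_le n M μ hMe hne
    unfold pathEnergy
    rw [sum_add_distrib, sum_add_distrib]
    linarith
  -- (3) the harmonic sum over the distinct paths: `n²·Σ_{j ∈ F} 1/(r+1) = n^d·H_n`
  have hharm : (n : ℝ) ^ 2 * ∑ j ∈ F, 1 / (3 * ((shell n e j : ℝ) + 1)) = (n : ℝ) ^ d * harm n / 3 := by
    have hall : ∑ j : Fin d → Fin n, 1 / (3 * ((shell n e j : ℝ) + 1)) = n * ∑ j ∈ F, 1 / (3 * ((shell n e j : ℝ) + 1)) :=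
      sum_update_const n ν (G := fun j => 1 / (3 * ((shell n e j : ℝ) + 1))) fun j t => by
        simp only [shell, Function.update_of_ne hne]
    have hdig := sum_digit_fn n e (fun t => 1 / (3 * ((t : ℝ) + 1)))
    simp only [shell] at hall ⊢
    rw [hall] at hdig
    have hH : ∑ t : Fin n, 1 / (3 * ((t : ℝ) + 1)) = harm n / 3 := by
      rw [harm, Fin.sum_univ_eq_sum_range (fun t => 1 / (3 * ((t : ℝ) + 1))) n, sum_div]
      exact sum_congr rfl fun t _ => by rw [div_div, mul_comm]
    rw [hH] at hdig
    -- `hdig : n * (n * S) = n^d * (harm/3)`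
    have : (n : ℝ) ^ 2 * ∑ j ∈ F, 1 / (3 * (((j e : ℕ) : ℝ) + 1)) = (n : ℝ) * ((n : ℝ) * ∑ j ∈ F, 1 / (3 * (((j e : ℕ) : ℝ) + 1))) := by ring
    rw [this, hdig]; ring
  have hsplit : ∑ j ∈ F, (n : ℝ) ^ 2 / (3 * ((shell n e j : ℝ) + 1)) = (n : ℝ) ^ 2 * ∑ j ∈ F, 1 / (3 * ((shell n e j : ℝ) + 1)) := by
    rw [mul_sum]; exact sum_congr rfl fun j _ => by ring
  rw [nsq_G]
  calc (n : ℝ) ^ d * harm n / 3 = ∑ j ∈ F, (n : ℝ) ^ 2 / (3 * ((shell n e j : ℝ) + 1)) := by rw [hsplit, hharm]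
    _ ≤ ∑ j ∈ F, pathEnergy n μ j := hpaths
    _ ≤ nsq (G n μ) := hdisj

/-! ## §3 The no-go -/

variable (a a' : ℝ) (w e ν)

/-- **NO-GO FOR A LEVEL-UNIFORM SLICE CONSTANT ON THE COMPLEMENT OF A DIAGONAL PAIR**: every slice constant `c ≥ 0` of the faithful region
operator on `S✗ = T ∖ {w, w + e + e_ν}` at level `n` obeys `c·H_n ≤ 6·d·a` (`0 ≤ a`, `0 < a′`, `e ≠ ν`, `2 ≤ M e`, `2 ≤ M ν`). [folklore] -/
theorem sliceCoercive_checker_le (hMe : 2 ≤ M e) (hMν : 2 ≤ M ν) (hne : e ≠ ν) (ha : 0 ≤ a) (ha' : 0 < a') {c : ℝ} (hc : 0 ≤ c)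
    (hS : SliceCoercive (curlR n M (checker M w e ν)) (gradR n M (checker M w e ν)) (GOm n M a' (checker M w e ν)) (QOm n M (checker M w e ν))
      (avgR n M (checker M w e ν)) (a * (n : ℝ) ^ d) c) :
    c * harm n ≤ 6 * d * a := by
  have hn0 : (0 : ℝ) < (n : ℝ) ^ d := pow_pos (by exact_mod_cast Nat.pos_of_ne_zero (NeZero.ne n)) d
  have hO := orthSlice_region_of_sliceCoercive n M a a' (checker M w e ν) ha' hc hS
  obtain ⟨μ, -, hμ⟩ := gaugePoincare_of_orthSlice n M a a' (checker M w e ν) ha' hO (testField n M w e ν)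
  rw [curlR_testField n hMe hMν hne] at hμ
  have h0 : nsq (0 : Tor (fine n M) × (Fin d × Fin d) → ℂ) = 0 := by simp [nsq]
  rw [h0, zero_add] at hμ
  have hmass := mass_testField_le n hMe hMν hne (w := w)
  have hcap := nsq_sub_gradR_testField_ge n M μ hMe hMν hne
  -- `c·n^d·H_n/3 ≤ c·nsq ≤ a·n^d·nsq (avgR A) ≤ 2d·a·n^d`
  have h1 : c * ((n : ℝ) ^ d * harm n / 3) ≤ a * (2 * d * (n : ℝ) ^ d) := by
    calc c * ((n : ℝ) ^ d * harm n / 3) ≤ c * nsq (testField n M w e ν - gradR n M (checker M w e ν) *ᵥ μ) :=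
          mul_le_mul_of_nonneg_left hcap hc
      _ ≤ a * (n : ℝ) ^ d * nsq (avgR n M (checker M w e ν) *ᵥ testField n M w e ν) := hμ
      _ = a * ((n : ℝ) ^ d * nsq (avgR n M (checker M w e ν) *ᵥ testField n M w e ν)) := by ring
      _ ≤ a * (2 * d * (n : ℝ) ^ d) := by
          exact mul_le_mul_of_nonneg_left hmass ha
  -- divide by `n^d/3`
  have h2 : c * harm n * (n : ℝ) ^ d ≤ 6 * d * a * (n : ℝ) ^ d := by nlinarith
  exact le_of_mul_le_mul_right h2 hn0

/-- the harmonic numbers are unbounded (the harmonic series diverges — Mathlib's `Real.tendsto_sum_range_one_div_nat_succ_atTop`).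
[folklore] -/
theorem harm_unbounded (C : ℝ) : ∃ m : ℕ, C < harm (m + 1) := by
  have h := Filter.tendsto_atTop_atTop.mp Real.tendsto_sum_range_one_div_nat_succ_atTop (C + 1)
  obtain ⟨N, hN⟩ := h
  refine ⟨N, ?_⟩
  have := hN (N + 1) (Nat.le_succ N)
  unfold harm
  linarith

/-- **NO LEVEL-UNIFORM SLICE CONSTANT EXISTS ON THE COMPLEMENT OF A DIAGONAL PAIR**: for every `c > 0` some level `n = m + 1` violates
`SliceCoercive … c` (`0 ≤ a`, `0 < a′`, `e ≠ ν`, `2 ≤ M e`, `2 ≤ M ν`) — the displayed W1 binder `hS : ∀ k, SliceCoercive …_k c` of the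
star-bond tower ENDs is UNSATISFIABLE for this region. [folklore] -/
theorem not_sliceCoercive_uniform_checker (hMe : 2 ≤ M e) (hMν : 2 ≤ M ν) (hne : e ≠ ν) (ha : 0 ≤ a) (ha' : 0 < a') {c : ℝ} (hc : 0 < c) :
    ∃ m : ℕ, ¬ SliceCoercive (curlR (m + 1) M (checker M w e ν)) (gradR (m + 1) M (checker M w e ν)) (GOm (m + 1) M a' (checker M w e ν))
      (QOm (m + 1) M (checker M w e ν)) (avgR (m + 1) M (checker M w e ν)) (a * (((m + 1 : ℕ)) : ℝ) ^ d) c := by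
  obtain ⟨m, hm⟩ := harm_unbounded (6 * d * a / c)
  refine ⟨m, fun hS => ?_⟩
  have h := sliceCoercive_checker_le (m + 1) M w e ν a a' hMe hMν hne ha ha' hc.le hS
  rw [div_lt_iff₀ hc] at hm
  linarith

end Summit.QuantumFields.BalabanUV.T4Continuum.RegionGaugeCheckerboardNoGo

end
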